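import Literature.AlgebraicGeometry.HodgeTheory.VertexProjectionComplexPoints
import Literature.AlgebraicGeometry.HodgeTheory.CycleClassPrincipalDivisorOffVertex
import Literature.AlgebraicGeometry.Resolution.BlowupsFlatBaseChange
import Literature.AlgebraicGeometry.Motives.AbelianVarietyProofs
import Literature.AlgebraicGeometry.Motives.VarietiesDimensionProofs
import HarnessLib

/-!
# The blow-up of `ℙ^{d+1}_ℂ` in the vertex: the hyperplane section of the projection, and `q = pr ∘ b` on complex points

Family `hodge`, layer `Literature/AlgebraicGeometry/HodgeTheory`. PROOF FILE (theorems only; no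
definition, no named fact). Let `b : T → ℙ^{d+1}_ℂ` be the blowing up of projective space in the
vertex `p = (0 : … : 0 : 1)` and `q : T → ℙ^d` the linear projection from `p` made a morphism (de
Jong 1996, proof of Lemma 4.11, p. 68; Eisenbud–Harris, *3264 and All That*, §9.3.2 and Prop. 9.11:
`T = ℙ(𝒪 ⊕ 𝒪(1))` is a `ℙ¹`-bundle over `ℙ^d` with two disjoint sections, the exceptional divisor
`b⁻¹(p)` and the strict transform of a hyperplane `H ∌ p`). The tree PROVES the existence of
`(T, b, q)` with `q` smooth, all fibres irreducible, `q = pr_p ∘ b` off `b⁻¹(p)`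
(`DeJong1996VertexBlowupProjection_holds`, `Resolution/AlterationsLemma411VertexBlowupHolds`), that
`T` is smooth projective (`isSmoothProjective_of_isBlowup_closedPoint`), and reads the projection
`pr_p` on complex points (`HodgeTheory/VertexProjectionComplexPoints`). This file adds the SECOND
section and the point-level dictionary needed to use `T` as the host of cones over subvarieties of
`ℙ^d` (the completed cone over `S ⊂ ℙ^d ≅ H` with vertex `p`, blown up at `p`, is `T ×_{ℙ^d} S`):

* `exists_hyperplaneSection_of_isVertexProjection` — **the hyperplane section**: a morphism
  `s : ℙ^d → T` with `s ≫ b = (ℙ^d ≅ V₊(x_{d+1}) ↪ ℙ^{d+1})` (`ProjectiveSpace.skipMap (Fin.last _)`)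
  and `s ≫ q = 𝟙` — the inverse of the isomorphism `b| : b⁻¹(ℙ^{d+1} ∖ p) ≅ ℙ^{d+1} ∖ p`
  (Stacks 02OS, `IsBlowup.isIso_morphismRestrict`) on the hyperplane, and
  `pr_p ∘ (y ↦ (y : 0)) = 𝟙` (`hyperplaneToPunctured_comp_vertexProjectionOver`);
* `comp_eq_pointOfVec_left_of_isVertexProjection` — **`q = pr_p ∘ b` on complex points**: if the
  complex point `t` of `T` has `b(t) = [u₀ : ⋯ : u_{d+1}]` with `(u₀, …, u_d) ≠ 0`, then
  `q(t) = [u₀ : ⋯ : u_d]` (`map_vertexProjectionOver_eq_pointOfVec`);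
* `eq_of_comp_eq_of_isBlowup_vertex`, `isIso_stalkMap_of_isBlowup_vertex` — `b` is one-to-one on
  complex points off the vertex and induces isomorphisms of local rings there;
* `smoothOfRelativeDimension_one_of_pointBlowupProjection` — `q` is smooth OF RELATIVE DIMENSION `1`
  (the fact gives `Smooth q`; the relative dimension is read off from `dim T = d + 1`);
  `isIrreducible_preimage_of_pointBlowupProjection` — the fibres `q⁻¹(y)` are irreducible SUBSETS;
* `exists_vertexBlowup_hyperplaneSection` — everything packaged over `ℂ` (`SchemeOver ℂ`,
  `ComplexPoints`, homogeneous coordinates `ProjectiveSpace.pointOfVec`).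

Spelling: at the scheme level `ℙⁿ_ℂ` is written `Proj ℂ[x₀, …, xₙ]` (`Segre.grading`), as in the
`Resolution/AlterationsLemma411Vertex*` files — `(projectiveSpace n ℂ).left` reduces to it by `rfl`,
and the final packaging over `ℂ` is stated with `projectiveSpace`.

## References

* [DeJong1996] A. J. de Jong, Smoothness, semi-stability and alterations, Publ. Math. IHÉS 83
  (1996), proof of Lemma 4.11, p. 68.
* [EisenbudHarris2016] D. Eisenbud, J. Harris, 3264 and All That, CUP 2016, §9.3.2, Prop. 9.11.
* [Hartshorne1977] R. Hartshorne, Algebraic Geometry, GTM 52, II Thm. 7.1, II Prop. 7.16 (c),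
  II Thm. 8.24 (a), III.10.
* [StacksProject] The Stacks Project, Tag 02OS.
* [GortzWedhorn2020] U. Görtz, T. Wedhorn, Algebraic Geometry I, 2nd ed. 2020, Prop. 13.91 (3),
  Lemma 6.26.
-/

noncomputable section

open CategoryTheory CategoryTheory.Limits AlgebraicGeometry
open Literature.AlgebraicGeometry.Motives Literature.AlgebraicGeometry.Resolution

attribute [local instance] MvPolynomial.gradedAlgebra

namespace Literature.AlgebraicGeometry.HodgeTheory

section HodgeTheory

variable (d : ℕ)

variable {P : Scheme.{0}} {b₀ : P ⟶ Proj (Segre.grading (Fin (d + 1 + 1)) ℂ)}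
  {q₀ : P ⟶ Proj (Segre.grading (Fin (d + 1)) ℂ)}

/-! ### The hyperplane section of `q` -/

/-- **The hyperplane section of the projection `q : T → ℙ^d` of the vertex blow-up.** For a
blowing up `b₀ : T → ℙ^{d+1}_ℂ` in the vertex `p = (0 : … : 0 : 1)` and `q₀ : T → ℙ^d` with
`q₀ = pr_p ∘ b₀` off `b₀⁻¹(p)` (`DeJong1996.IsVertexProjection`), there is `s₀ : ℙ^d → T` with
`s₀ ≫ b₀ = (y ↦ (y : 0))`, the coordinate hyperplane `V₊(x_{d+1})`, and `s₀ ≫ q₀ = 𝟙`: compose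
`ℙ^d ≅ V₊(x_{d+1}) ↪ ℙ^{d+1} ∖ {p}` with the inverse of `b₀| : b₀⁻¹(ℙ^{d+1} ∖ {p}) ≅ ℙ^{d+1} ∖ {p}`
(Stacks 02OS); then `s₀ ≫ q₀ = (y ↦ (y : 0)) ≫ pr_p = 𝟙`. This is the second section
`ℙ(𝒪) ⊂ ℙ(𝒪 ⊕ 𝒪(1)) = T` of the `ℙ¹`-bundle, disjoint from the exceptional divisor.
[cite: EisenbudHarris2016, §9.3.2 and Prop. 9.11] [cite: StacksProject, Tag 02OS] -/
theorem exists_hyperplaneSection_of_isVertexProjection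
    (hb : IsBlowup b₀ (DeJong1996.vertexIdealSheaf d ℂ))
    (hV : DeJong1996.IsVertexProjection d ℂ b₀ q₀) :
    ∃ s₀ : (projectiveSpace d ℂ).left ⟶ P,
      s₀ ≫ b₀ = (ProjectiveSpace.skipMap (k := ℂ) (Fin.last (d + 1))).left ∧ s₀ ≫ q₀ = 𝟙 _ := by
  set e := @asIso _ _ _ _ (b₀ ∣_ DeJong1996.puncturedSpace d ℂ)
    (DeJong1996.isIso_morphismRestrict_puncturedSpace hb) with he
  refine ⟨hyperplaneToPunctured₀ d ≫ e.inv ≫ (b₀ ⁻¹ᵁ DeJong1996.puncturedSpace d ℂ).ι, ?_, ?_⟩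
  · rw [Category.assoc, Category.assoc, ← morphismRestrict_ι]
    change _ ≫ e.inv ≫ e.hom ≫ _ = _
    rw [e.inv_hom_id_assoc, hyperplaneToPunctured₀_ι]
  · rw [Category.assoc, Category.assoc, hV.preimage_ι_comp d ℂ]
    change _ ≫ e.inv ≫ e.hom ≫ _ = _
    rw [e.inv_hom_id_assoc]
    exact congrArg CommaMorphism.left (hyperplaneToPunctured_comp_vertexProjectionOver d)

/-! ### `q = pr_p ∘ b` on complex points; `b` off the vertex -/

/-- **`q = pr_p ∘ b` on complex points.** If a complex point `t : Spec ℂ → T` has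
`t ≫ b₀ = [u₀ : ⋯ : u_{d+1}]` with `(u₀, …, u_d) ≠ 0` (so `b₀(t)` is not the vertex), then
`t ≫ q₀ = [u₀ : ⋯ : u_d]`: `t` factors through `b₀⁻¹(ℙ^{d+1} ∖ {p})`, where `q₀ = pr_p ∘ b₀`
(`IsVertexProjection.preimage_ι_comp`), and `pr_p[u] = [u₀ : ⋯ : u_d]`
(`map_vertexProjectionOver_eq_pointOfVec`). [cite: DeJong1996, Lemma 4.11 (proof), p. 68] -/
theorem comp_eq_pointOfVec_left_of_isVertexProjection
    (hV : DeJong1996.IsVertexProjection d ℂ b₀ q₀)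
    (t : Spec (.of ℂ) ⟶ P) (u : Fin (d + 1 + 1) → ℂ) (hu : u ≠ 0)
    (ht : t ≫ b₀ = (ProjectiveSpace.pointOfVec ℂ u hu).left)
    (hu' : (u ∘ Fin.castSucc : Fin (d + 1) → ℂ) ≠ 0) :
    t ≫ q₀ = (ProjectiveSpace.pointOfVec ℂ (u ∘ Fin.castSucc) hu').left := by
  set U := DeJong1996.puncturedSpace d ℂ with hUdef
  -- `t` factors through `b₀⁻¹(ℙ ∖ vertex)`
  have hrange : Set.range t.base ⊆ Set.range (b₀ ⁻¹ᵁ U).ι.base := by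
    rintro _ ⟨v, rfl⟩
    rw [Scheme.Opens.range_ι]
    change b₀.base (t.base v) ∈ U
    rw [hUdef, DeJong1996.mem_puncturedSpace_iff]
    have hv : (t ≫ b₀).base v = (ProjectiveSpace.pointOfVec ℂ u hu).pt := by
      have h1 : v = IsLocalRing.closedPoint ℂ := Subsingleton.elim _ _
      rw [ht, h1]
      rfl
    intro hvx
    apply hu'
    funext i
    refine (pt_pointOfVec_eq_vertex_iff d u hu).1 ?_ i
    rw [← hv]
    exact hvx
  set t' := IsOpenImmersion.lift (b₀ ⁻¹ᵁ U).ι t hrange with ht'def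
  have ht' : t' ≫ (b₀ ⁻¹ᵁ U).ι = t := IsOpenImmersion.lift_fac _ _ _
  -- the point `t' ≫ b₀|` of the punctured space over `ℂ`
  set Pl := t' ≫ (b₀ ∣_ U) with hPl
  have hPlι : Pl ≫ U.ι = t ≫ b₀ := by
    rw [hPl, Category.assoc, morphismRestrict_ι, ← Category.assoc, ht']
  have hPlw : Pl ≫ (puncturedOver d).hom = (specOver ℂ ℂ).hom := by
    change Pl ≫ U.ι ≫ (projectiveSpace (d + 1) ℂ).hom = _
    rw [← Category.assoc, hPlι, ht]
    exact Over.w (ProjectiveSpace.pointOfVec ℂ u hu)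
  set Q : ComplexPoints (puncturedOver d) := AlgPoints.mk Pl hPlw with hQ
  have hQι : AlgPoints.map (puncturedOverι d) Q = ProjectiveSpace.pointOfVec ℂ u hu := by
    ext : 1
    rw [← ht]
    exact hPlι
  have hq := map_vertexProjectionOver_eq_pointOfVec d Q u hu hQι hu'
  have hq' : Pl ≫ DeJong1996.vertexProjection d ℂ =
      (ProjectiveSpace.pointOfVec ℂ (u ∘ Fin.castSucc) hu').left := by
    rw [← hq]
    rfl
  rw [← hq', hPl, Category.assoc, ← hV.preimage_ι_comp d ℂ, ← Category.assoc, ht']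

/-- **`b` is one-to-one on complex points off the vertex**: two complex points `t₁, t₂ : Spec ℂ → T`
with `t₁ ≫ b₀ = t₂ ≫ b₀` not the vertex coincide — both factor through `b₀⁻¹(ℙ^{d+1} ∖ {p})`, on
which `b₀` restricts to an isomorphism (Stacks 02OS). [cite: StacksProject, Tag 02OS] -/
theorem eq_of_comp_eq_of_isBlowup_vertex (hb : IsBlowup b₀ (DeJong1996.vertexIdealSheaf d ℂ))
    (t₁ t₂ : Spec (.of ℂ) ⟶ P) (h : t₁ ≫ b₀ = t₂ ≫ b₀)
    (ht : ∀ v, (t₁ ≫ b₀).base v ≠ DeJong1996.vertex d ℂ) : t₁ = t₂ := by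
  set U := DeJong1996.puncturedSpace d ℂ with hUdef
  have hrange : ∀ {t : Spec (.of ℂ) ⟶ P}, (∀ v, (t ≫ b₀).base v ≠ DeJong1996.vertex d ℂ) →
      Set.range t.base ⊆ Set.range (b₀ ⁻¹ᵁ U).ι.base := by
    intro t htv
    rintro _ ⟨v, rfl⟩
    rw [Scheme.Opens.range_ι]
    change b₀.base (t.base v) ∈ U
    rw [hUdef, DeJong1996.mem_puncturedSpace_iff]
    exact htv v
  have h₂ : ∀ v, (t₂ ≫ b₀).base v ≠ DeJong1996.vertex d ℂ := by rw [← h]; exact ht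
  set t₁' := IsOpenImmersion.lift (b₀ ⁻¹ᵁ U).ι t₁ (hrange ht) with ht₁'def
  set t₂' := IsOpenImmersion.lift (b₀ ⁻¹ᵁ U).ι t₂ (hrange h₂) with ht₂'def
  have ht₁' : t₁' ≫ (b₀ ⁻¹ᵁ U).ι = t₁ := IsOpenImmersion.lift_fac _ _ _
  have ht₂' : t₂' ≫ (b₀ ⁻¹ᵁ U).ι = t₂ := IsOpenImmersion.lift_fac _ _ _
  haveI : IsIso (b₀ ∣_ U) := DeJong1996.isIso_morphismRestrict_puncturedSpace hb
  have hkey : t₁' ≫ (b₀ ∣_ U) = t₂' ≫ (b₀ ∣_ U) := by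
    rw [← cancel_mono U.ι, Category.assoc, Category.assoc, morphismRestrict_ι,
      ← Category.assoc, ← Category.assoc, ht₁', ht₂', h]
  rw [cancel_mono] at hkey
  rw [← ht₁', ← ht₂', hkey]

/-- **`b` induces isomorphisms of local rings off the vertex** (a blowing up is an isomorphism
over the complement of its centre, Stacks 02OS; `isIso_stalkMap_of_isIso_morphismRestrict`).
[cite: StacksProject, Tag 02OS] -/
theorem isIso_stalkMap_of_isBlowup_vertex (hb : IsBlowup b₀ (DeJong1996.vertexIdealSheaf d ℂ))
    (t : P) (ht : b₀.base t ≠ DeJong1996.vertex d ℂ) : IsIso (b₀.stalkMap t) :=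
  @isIso_stalkMap_of_isIso_morphismRestrict _ _ b₀ (DeJong1996.puncturedSpace d ℂ)
    (DeJong1996.isIso_morphismRestrict_puncturedSpace hb) t
    ((DeJong1996.mem_puncturedSpace_iff d ℂ _).2 ht)

/-! ### Smoothness of relative dimension one; irreducible fibres -/

/-- The blow-up of `ℙ^{d+1}_ℂ` in the vertex is a smooth projective `(d+1)`-fold over `ℂ` — the
tree's `isSmoothProjective_of_isBlowup_closedPoint`, read in the `Proj` spelling.
[cite: Hartshorne1977, II Thm. 8.24 (a) and Prop. 7.16 (c)] -/
theorem isSmoothProjective_mk_of_pointBlowupProjection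
    (hM : DeJong1996.PointBlowupProjection d ℂ (DeJong1996.vertex d ℂ) b₀ q₀) :
    IsSmoothProjective (d + 1)
      (Over.mk (b₀ ≫ Segre.toSpec (Fin (d + 1 + 1)) ℂ) : SchemeOver ℂ) :=
  isSmoothProjective_of_isBlowup_closedPoint (isSmoothProjective_projectiveSpace' (d + 1))
    (DeJong1996.isClosed_singleton_vertex d ℂ) (DeJong1996.vertexIdealSheaf_ne_bot d ℂ) hM.isBlowup

/-- **The projection `q : T → ℙ^d` of the vertex blow-up is smooth of relative dimension `1`**
("a `ℙ¹`-bundle"). The fact gives `Smooth q₀`; as `T` is irreducible, `q₀` is smooth of some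
relative dimension `r` (`exists_smoothOfRelativeDimension_of_smooth`), and then
`T → ℙ^d → Spec ℂ` is smooth of relative dimension `r + d`, while `dim T = d + 1`
(`topologicalKrullDim_eq_of_smoothOfRelativeDimension`, Görtz–Wedhorn I Lemma 6.26), so `r = 1`.
[cite: DeJong1996, Lemma 4.11 (proof), p. 68] [cite: GortzWedhorn2020, Lemma 6.26] -/
theorem smoothOfRelativeDimension_one_of_pointBlowupProjection
    (hM : DeJong1996.PointBlowupProjection d ℂ (DeJong1996.vertex d ℂ) b₀ q₀) :
    SmoothOfRelativeDimension 1 q₀ := by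
  have hT := isSmoothProjective_mk_of_pointBlowupProjection d hM
  haveI : IrreducibleSpace P := irreducibleSpace_of_isSmoothProjective' hT
  haveI : Smooth q₀ := hM.smooth
  obtain ⟨r, hr⟩ := exists_smoothOfRelativeDimension_of_smooth q₀
  haveI := hr
  haveI : SmoothOfRelativeDimension d (Segre.toSpec (Fin (d + 1)) ℂ) :=
    (isSmoothProjective_projectiveSpace' d).smoothOfRelativeDimension
  have h1 : SmoothOfRelativeDimension (r + d) (q₀ ≫ Segre.toSpec (Fin (d + 1)) ℂ) := inferInstance
  have h2 : SmoothOfRelativeDimension (d + 1) (b₀ ≫ Segre.toSpec (Fin (d + 1 + 1)) ℂ) :=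
    hT.smoothOfRelativeDimension
  have hcomp : q₀ ≫ Segre.toSpec (Fin (d + 1)) ℂ = b₀ ≫ Segre.toSpec (Fin (d + 1 + 1)) ℂ := hM.comp_hom
  rw [hcomp] at h1
  have e1 := topologicalKrullDim_eq_of_smoothOfRelativeDimension
    (f := b₀ ≫ Segre.toSpec (Fin (d + 1 + 1)) ℂ) (n := r + d)
  have e2 := topologicalKrullDim_eq_of_smoothOfRelativeDimension
    (f := b₀ ≫ Segre.toSpec (Fin (d + 1 + 1)) ℂ) (n := d + 1)
  have hr1 : r = 1 := by
    have : ((r + d : ℕ) : WithBot ℕ∞) = ((d + 1 : ℕ) : WithBot ℕ∞) := e1.symm.trans e2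
    have := (Nat.cast_injective (R := WithBot ℕ∞)) this
    omega
  subst hr1
  exact hr

/-- **The fibres `q⁻¹(y)` of the projection are irreducible subsets of `T`** (the fact gives
irreducible fibre SCHEMES; their underlying sets are the preimages, `Scheme.Hom.range_fiberι`).
[cite: DeJong1996, Lemma 4.11 (proof), p. 68] -/
theorem isIrreducible_preimage_of_pointBlowupProjection
    (hM : DeJong1996.PointBlowupProjection d ℂ (DeJong1996.vertex d ℂ) b₀ q₀)
    (y : Proj (Segre.grading (Fin (d + 1)) ℂ)) : IsIrreducible (q₀.base ⁻¹' {y}) := by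
  haveI : IrreducibleSpace ↥(q₀.fiber y) := hM.irreducibleSpace_fiber y
  have h := (IrreducibleSpace.isIrreducible_univ ↥(q₀.fiber y)).image
    (q₀.fiberι y).base (Scheme.Hom.continuous _).continuousOn
  rwa [Set.image_univ, Scheme.Hom.range_fiberι] at h

/-! ### Packaging over `ℂ` -/

/-- The blow-up of `ℙ^{d+1}_ℂ` in the vertex with its projection, from the tree's proved fact
`DeJong1996VertexBlowupProjection_holds`, in the `Proj` spelling of `ℙ^{d+1}`, `ℙ^d`.
[cite: DeJong1996, Lemma 4.11 (proof), p. 68] -/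
theorem exists_pointBlowupProjection_complex :
    ∃ (P : Scheme.{0}) (b₀ : P ⟶ Proj (Segre.grading (Fin (d + 1 + 1)) ℂ))
      (q₀ : P ⟶ Proj (Segre.grading (Fin (d + 1)) ℂ)),
      DeJong1996.PointBlowupProjection d ℂ (DeJong1996.vertex d ℂ) b₀ q₀ ∧
        DeJong1996.IsVertexProjection d ℂ b₀ q₀ :=
  DeJong1996VertexBlowupProjection_holds ℂ d

/-- **The blow-up of `ℙ^{d+1}_ℂ` in the vertex `p = (0 : … : 0 : 1)`, its projection to `ℙ^d`, and the
hyperplane section, over `ℂ`.** There are a smooth projective `(d+1)`-fold `T`, `b : T → ℙ^{d+1}`,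
`q : T → ℙ^d` smooth of relative dimension `1` with irreducible fibres, and `s : ℙ^d → T` with
`s ≫ q = 𝟙` and `s ≫ b = (y ↦ (y : 0))` (`ProjectiveSpace.skipMap (Fin.last _)`), such that, in
homogeneous coordinates (`ProjectiveSpace.pointOfVec`): for complex points `t` of `T` with
`b(t) = [u]`, `(u₀, …, u_d) ≠ 0` — i.e. `b(t) ≠ p` — the local ring map of `b` at `t` is an
isomorphism, `b` is one-to-one on such points, and `q(t) = [u₀ : ⋯ : u_d]`. (`T = ℙ(𝒪 ⊕ 𝒪(1))`,
the graph of the projection from `p`; de Jong 1996, proof of 4.11; Eisenbud–Harris Prop. 9.11.)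
[cite: DeJong1996, Lemma 4.11 (proof), p. 68] [cite: EisenbudHarris2016, §9.3.2 and Prop. 9.11]
[cite: StacksProject, Tag 02OS] -/
theorem exists_vertexBlowup_hyperplaneSection :
    ∃ (T : SchemeOver ℂ) (b : T ⟶ projectiveSpace (d + 1) ℂ) (q : T ⟶ projectiveSpace d ℂ)
      (s : projectiveSpace d ℂ ⟶ T),
      IsSmoothProjective (d + 1) T ∧ SmoothOfRelativeDimension 1 q.left ∧
      (∀ y, IsIrreducible (q.left.base ⁻¹' {y})) ∧
      s ≫ q = 𝟙 _ ∧ s ≫ b = ProjectiveSpace.skipMap (k := ℂ) (Fin.last (d + 1)) ∧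
      (∀ (t : ComplexPoints T) (u : Fin (d + 1 + 1) → ℂ) (hu : u ≠ 0),
        (u ∘ Fin.castSucc : Fin (d + 1) → ℂ) ≠ 0 →
        AlgPoints.map b t = ProjectiveSpace.pointOfVec ℂ u hu → IsIso (b.left.stalkMap t.pt)) ∧
      (∀ (t₁ t₂ : ComplexPoints T) (u : Fin (d + 1 + 1) → ℂ) (hu : u ≠ 0),
        (u ∘ Fin.castSucc : Fin (d + 1) → ℂ) ≠ 0 →
        AlgPoints.map b t₁ = ProjectiveSpace.pointOfVec ℂ u hu →
        AlgPoints.map b t₂ = ProjectiveSpace.pointOfVec ℂ u hu → t₁ = t₂) ∧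
      (∀ (t : ComplexPoints T) (u : Fin (d + 1 + 1) → ℂ) (hu : u ≠ 0)
        (hu' : (u ∘ Fin.castSucc : Fin (d + 1) → ℂ) ≠ 0),
        AlgPoints.map b t = ProjectiveSpace.pointOfVec ℂ u hu →
        AlgPoints.map q t = ProjectiveSpace.pointOfVec ℂ (u ∘ Fin.castSucc) hu') := by
  obtain ⟨P, b₀, q₀, hM, hV⟩ := exists_pointBlowupProjection_complex d
  obtain ⟨s₀, hsb, hsq⟩ := exists_hyperplaneSection_of_isVertexProjection d hM.isBlowup hV
  let T : SchemeOver ℂ := Over.mk (b₀ ≫ Segre.toSpec (Fin (d + 1 + 1)) ℂ)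
  let b : T ⟶ projectiveSpace (d + 1) ℂ := Over.homMk b₀ rfl
  let q : T ⟶ projectiveSpace d ℂ := Over.homMk q₀ hM.comp_hom
  have hsw : s₀ ≫ T.hom = (projectiveSpace d ℂ).hom := by
    change s₀ ≫ b₀ ≫ Segre.toSpec (Fin (d + 1 + 1)) ℂ = _
    rw [← Category.assoc, hsb]
    exact Over.w (ProjectiveSpace.skipMap (k := ℂ) (Fin.last (d + 1)))
  let s : projectiveSpace d ℂ ⟶ T := Over.homMk s₀ hsw
  -- a point `[u]` with `(u₀, …, u_d) ≠ 0` is not the vertex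
  have hnv : ∀ (t : ComplexPoints T) (u : Fin (d + 1 + 1) → ℂ) (hu : u ≠ 0),
      (u ∘ Fin.castSucc : Fin (d + 1) → ℂ) ≠ 0 →
      AlgPoints.map b t = ProjectiveSpace.pointOfVec ℂ u hu →
      ∀ v : Spec (.of ℂ), (t.left ≫ b₀).base v ≠ DeJong1996.vertex d ℂ := by
    intro t u hu hu' ht v hvx
    have h1 : v = IsLocalRing.closedPoint ℂ := Subsingleton.elim _ _
    have hv : (t.left ≫ b₀).base v = (ProjectiveSpace.pointOfVec ℂ u hu).pt := by
      rw [h1, ← ht]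
      rfl
    apply hu'
    funext i
    refine (pt_pointOfVec_eq_vertex_iff d u hu).1 ?_ i
    rw [← hv]
    exact hvx
  refine ⟨T, b, q, s, isSmoothProjective_mk_of_pointBlowupProjection d hM,
    smoothOfRelativeDimension_one_of_pointBlowupProjection d hM,
    isIrreducible_preimage_of_pointBlowupProjection d hM, ?_, ?_, ?_, ?_, ?_⟩
  · ext : 1
    exact hsq
  · ext : 1
    exact hsb
  · intro t u hu hu' ht
    have h1 : t.pt = t.left.base (IsLocalRing.closedPoint ℂ) := rfl
    rw [h1]
    exact isIso_stalkMap_of_isBlowup_vertex d hM.isBlowup _ (hnv t u hu hu' ht _)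
  · intro t₁ t₂ u hu hu' h₁ h₂
    have h : t₁.left ≫ b₀ = t₂.left ≫ b₀ := by
      change (AlgPoints.map b t₁).left = (AlgPoints.map b t₂).left
      rw [h₁, h₂]
    ext : 1
    exact eq_of_comp_eq_of_isBlowup_vertex d hM.isBlowup _ _ h (hnv t₁ u hu hu' h₁)
  · intro t u hu hu' ht
    ext : 1
    exact comp_eq_pointOfVec_left_of_isVertexProjection d hV t.left u hu
      (congrArg CommaMorphism.left ht) hu'

end HodgeTheory

end Literature.AlgebraicGeometry.HodgeTheory

end
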